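import Summits.CriticalPhenomena.PercolationContinuityZ3.Theorems.PercNearOneGluingNoHeavyLowerTailSahiCombTriWAndOrAndThree
import Summits.CriticalPhenomena.PercolationContinuityZ3.Theorems.PercNearOneGluingNoHeavyLowerTailSahiCombTriWAndLattice3

/-!
# AND with a block on four coordinates: the remaining complement tables in `Fin 4` (infrastructure)

Support file of the one-cut programme (crux `NoHeavyLowerTail`, stmt-CriticalPhenomena-4575; unit `prim-lf-1` gen 45, memo
`FROM-prim-lf-1-gen45-AND-OR3.md`).  The machine-generated block files on `Fin 4` (`…SahiCombTriWAndOrAndThree` and its successors, produced by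
`HOME/code/gen45/lab/genlean_block.py`) rewrite `yᶜ` for the members `y` of the block; eight of the fourteen tables already live in
`…AndOrAndThree` (`compl_fin4_0_orAndThree`, …); this file supplies the other six under canonical names and is the single import
(together with the threefold lattice atoms of `…AndLattice3`) for every further `Fin 4` block file.
HONEST LABEL: bookkeeping only, complete proofs, std axioms. [this work]
-/

namespace Summit.CriticalPhenomena.PercolationContinuityZ3.Theorems

namespace FiveUpSet

open Finset

/-- Complement table in `Fin 4`. [this work] -/
theorem compl_fin4_1 : ({1} : Finset (Fin 4))ᶜ = {0, 2, 3} := by decide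
/-- Complement table in `Fin 4`. [this work] -/
theorem compl_fin4_2 : ({2} : Finset (Fin 4))ᶜ = {0, 1, 3} := by decide
/-- Complement table in `Fin 4`. [this work] -/
theorem compl_fin4_3 : ({3} : Finset (Fin 4))ᶜ = {0, 1, 2} := by decide
/-- Complement table in `Fin 4`. [this work] -/
theorem compl_fin4_12 : ({1, 2} : Finset (Fin 4))ᶜ = {0, 3} := by decide
/-- Complement table in `Fin 4`. [this work] -/
theorem compl_fin4_13 : ({1, 3} : Finset (Fin 4))ᶜ = {0, 2} := by decide
/-- Complement table in `Fin 4`. [this work] -/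
theorem compl_fin4_23 : ({2, 3} : Finset (Fin 4))ᶜ = {0, 1} := by decide

end FiveUpSet

end Summit.CriticalPhenomena.PercolationContinuityZ3.Theorems
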